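import Summits.BirchSwinnertonDyer.Rank1Residual.ManinAdditive.TowerExtension

/-!
# The FAREY GRAPH is connected; E-an-140 `QFareyFibreConnected 1 q` at level `N = 1` (cell bsd-f2-manin, analytic lens g30,
# MEMO-an §72.3 / Sketch-an-g30 §3; the `N = 1` instance of the typed law, where the fibre is all of `ℚ` and the Farey edges suffice)

Summit `BirchSwinnertonDyer`, route `ManinLocalTwoThree`, cruxes C3 `ManinPrimeToThreeAtNine` (stmt-BirchSwinnertonDyer-22968) / C2 `ManinOddAtFour`
(stmt-…-22967).  The law E-an-140 `TowerExtension.QFareyFibreConnected N q` (q-Farey graph on the denominator fibre `±⟨q⟩` is connected) is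
the combinatorial heart of the EXTENSION step (§72.3).  At `N = 1` every reduced fraction is a vertex and the FAREY edges `|BD′ − B′D| = 1 = q⁰`
already connect it to `0/1`: the classical descent along a Bezout neighbour with smaller denominator.  (For `N ≥ 2` the Farey sub-graph of the
fibre is DISconnected — an's farey_fibre.py — and the `q`-power edges / E-an-141 are essential; not treated here.)

* `fareyAdj_reflTransGen_zero` — every reduced `B/D`, `D ≥ 1`, is joined to `0/1` by a chain of Farey neighbours (`|BD′ − B′D| = 1`, all
  intermediate fractions reduced with positive denominators).
* `qFareyFibreConnected_one : ∀ q, TowerExtension.QFareyFibreConnected 1 q` — E-an-140 at `N = 1`, BY NAME.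

HONEST FRAMING: elementary; E-an-140 for `N ≥ 2` (the cases the cruxes need) remains OPEN (⟸ E-an-141, now a tree theorem, via the orbit-graph
lemma `…Theorems.ManinLocalTwoThreeOrbitGraph` once the `Γ_S`-action on the fibre is formalised).  Nothing about Manin's conjecture or BSD.
-/

set_option linter.dupNamespace false
set_option autoImplicit false

namespace Summit.BirchSwinnertonDyer.BirchSwinnertonDyer.Theorems.ManinLocalTwoThree

open Summit.BirchSwinnertonDyer.Rank1Residual.ManinAdditive.TowerExtension

/-- Integers `B/1` are joined to `0/1` along `…, (k/1) ∼ ((k+1)/1), …` (Farey adjacency `|B D′ − B′ D| = 1` on reduced fractions with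
positive denominators, written out). -/
private theorem farey_int (B : ℤ) : Relation.ReflTransGen (fun x y : ℤ × ℕ ↦
      0 < x.2 ∧ 0 < y.2 ∧ Int.gcd x.1 x.2 = 1 ∧ Int.gcd y.1 y.2 = 1 ∧ |x.1 * (y.2 : ℤ) - y.1 * (x.2 : ℤ)| = 1)
      ((0 : ℤ), 1) (B, 1) := by
  induction B using Int.induction_on with
  | zero => exact Relation.ReflTransGen.refl
  | succ k ih =>
    refine ih.tail ?_
    refine ⟨one_pos, one_pos, by simp, by simp, ?_⟩
    simp
  | pred k ih =>
    refine ih.tail ?_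
    refine ⟨one_pos, one_pos, by simp, by simp, ?_⟩
    simp

/-- **The Farey graph is connected**: every reduced fraction `B/D` (`D ≥ 1`, `gcd(B, D) = 1`) is joined to `0/1` by a chain of Farey
neighbours — descent along a Bezout neighbour `B′/D′` with `0 < D′ < D`, `B D′ − B′ D = 1`. [folklore] -/
theorem fareyAdj_reflTransGen_zero (D : ℕ) (B : ℤ) (hD : 0 < D) (hBD : Int.gcd B D = 1) :
    Relation.ReflTransGen (fun x y : ℤ × ℕ ↦
      0 < x.2 ∧ 0 < y.2 ∧ Int.gcd x.1 x.2 = 1 ∧ Int.gcd y.1 y.2 = 1 ∧ |x.1 * (y.2 : ℤ) - y.1 * (x.2 : ℤ)| = 1)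
      ((0 : ℤ), 1) (B, D) := by
  induction D using Nat.strong_induction_on generalizing B with
  | _ D ih =>
    by_cases hD1 : D = 1
    · subst hD1; exact farey_int B
    · have hD2 : 2 ≤ D := by omega
      -- Bezout neighbour: `B D' − B' D = 1`
      have hcop : IsCoprime B (D : ℤ) := Int.isCoprime_iff_gcd_eq_one.mpr hBD
      obtain ⟨s, t, hst⟩ := hcop   -- `s * B + t * D = 1`
      -- reduce `s` modulo `D`: `D'' := s mod D ∈ (0, D)`, `B'' := -t - (s / D) * B`... keep `B D'' − B'' D = 1`
      set D'' : ℤ := s % (D : ℤ) with hD''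
      set k : ℤ := s / (D : ℤ) with hk
      set B'' : ℤ := -t - k * B with hB''
      have hsk : s = D'' + (D : ℤ) * k := by
        have h := Int.emod_add_mul_ediv s (D : ℤ)
        rw [hD'', hk]
        linear_combination -h
      have hdet : B * D'' - B'' * (D : ℤ) = 1 := by
        rw [hB'']
        linear_combination hst - B * hsk
      have hD''nn : 0 ≤ D'' := Int.emod_nonneg _ (by exact_mod_cast hD.ne')
      have hD''lt : D'' < (D : ℤ) := Int.emod_lt_of_pos _ (by exact_mod_cast hD)
      have hD''pos : 0 < D'' := by
        rcases hD''nn.lt_or_eq with h | h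
        · exact h
        · exfalso
          rw [← h, mul_zero, zero_sub] at hdet
          have : (D : ℤ) ∣ 1 := ⟨-B'', by linear_combination -hdet⟩
          have hD1' : (D : ℤ) ≤ 1 := Int.le_of_dvd one_pos this
          omega
      -- the neighbour as a natural-denominator reduced fraction
      obtain ⟨E, hE⟩ : ∃ E : ℕ, (E : ℤ) = D'' := ⟨D''.toNat, Int.toNat_of_nonneg hD''nn⟩
      have hEpos : 0 < E := by omega
      have hElt : E < D := by omega
      have hgcdE : Int.gcd B'' E = 1 := by
        rw [← Int.isCoprime_iff_gcd_eq_one]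
        exact ⟨-(D : ℤ), B, by rw [hE]; linear_combination hdet⟩
      have hpath := ih E hElt B'' hEpos hgcdE
      refine hpath.tail ⟨hEpos, hD, hgcdE, hBD, ?_⟩
      rw [hE]
      rw [show B'' * (D : ℤ) - B * D'' = -(B * D'' - B'' * (D : ℤ)) by ring, hdet]
      norm_num

/-- **E-an-140 at level `N = 1`, BY NAME: `QFareyFibreConnected 1 q`** — the fibre is all of `ℚ` and the Farey edges (`e = 0`) connect every
reduced fraction to `0/1`. -/
theorem qFareyFibreConnected_one (q : ℕ) : QFareyFibreConnected 1 q := by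
  intro _ _ _ B D hD hBD _
  have hfib : ∀ D : ℕ, InFibre 1 q D := fun D ↦
    ⟨Nat.coprime_one_right D, 0, Or.inl (Subsingleton.elim _ _)⟩
  have hle : (fun x y : ℤ × ℕ ↦
      0 < x.2 ∧ 0 < y.2 ∧ Int.gcd x.1 x.2 = 1 ∧ Int.gcd y.1 y.2 = 1 ∧ |x.1 * (y.2 : ℤ) - y.1 * (x.2 : ℤ)| = 1) ≤
      QFareyAdj 1 q := by
    intro x y hxy
    obtain ⟨hx, hy, hgx, hgy, hdet⟩ := hxy
    exact ⟨hx, hy, hgx, hgy, hfib x.2, hfib y.2, 0, by rw [pow_zero]; exact hdet⟩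
  exact Relation.ReflTransGen.mono hle _ _ (fareyAdj_reflTransGen_zero D B hD hBD)

end Summit.BirchSwinnertonDyer.BirchSwinnertonDyer.Theorems.ManinLocalTwoThree
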